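import Literature.NumberTheory.EllipticCurves.ModularSymbols
import Literature.NumberTheory.EllipticCurves.ComplexMultiplication
import HarnessLib

/-!
# `r_an(E) = 0` FROM AN ENCLOSURE OF `L(E,1)/ω₁`: the data binder `W.analyticRank = 0` of a rank-0 Kurihara
# OFFER whose level has a prime with `a_ℓ = 2` (so that its bin enclosure `hballL` is blind to `L(E,1)`),
# discharged from the engine's level-one quantity `T₀ = L(E,1)/ω₁` certified in the SAME job

Cell `b2b-bsdres`, supersingular family, prover A = unit `b2b-bsdres-x10b` (gen 21).  Topic file; namespace
`Summit.BirchSwinnertonDyer.Rank1Residual.Supersingular`.  THEOREMS ONLY (no definition, no named fact,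
nothing asserted about any curve, nothing booked); X6 / X7 stay CONSTRUCTION-SHAPED (RESIDUAL-MAP §I N4 / N5).
Companion of `AnalyticRankZeroOfLValueBall.lean` (gen 21): there, `r_an = 0` follows from the bin enclosure
`hballL` whenever `A = Π_{ℓ∣n}(a_ℓ − 2) ≠ 0` (355 of the 608 A-side rank-0 offers); on the other 253 offers the
recorded combination `A·L(E,1) + Σ_{j≠0} …` does not see `L(E,1)`.  For those the engine's job output carries,
next to the bins, the certified rounding of `T₀ = L(E,1)/ω₁ = c_∞·L(E,1)/Ω⁺_f` (implementation 3c/3d field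
`T0_cert`: value `I/den`, `|den·T₀_ball.mid − I| = margin`, radius `rad`, `margin + rad < 1/2`; `ω₁` by AGM,
cross-checked against PARI) — the level-ONE analogue of `hballL`, displayed as the binder

`hball0 : ∃ mid rad, rad ≤ R ∧ |mid − I| ≤ Mr ∧ |den·(c_∞·(re L(E,1)/Ω⁺_f)) − mid| ≤ rad`.

HONEST FRAMING (run/shared/lean/b2b/bsd-rank1-residual/, verbatim in every file): the goal of the
cell is to DELETE the COMBINATION-SHAPED residual classes of the Birch–Swinnerton-Dyer formula for
ALL analytic-rank `≤ 1` elliptic curves over `ℚ` — "full BSD formula for every rank `≤ 1` curve in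
class `C`" assembled STRICTLY from published theorems — so that the rank-`≤ 1` remainder becomes
exactly the CONSTRUCTION-SHAPED classes, which are TYPED (missing-input `Prop`s), NOT attempted.
This is not "finishing BSD".

## What this file proves

* **`entireLFunction_one_ne_zero_of_LOneBall`** — if `I ≠ 0` and `R + Mr < 1` then `hball0` forces
  `L(E,1) ≠ 0`: were `L(E,1) = 0`, the enclosed quantity would be `0`, so `|I| ≤ |I − mid| + |mid| ≤ Mr + R < 1`.
  No hypothesis on `den`, `c_∞`, `Ω⁺_f`.
* **`analyticRank_eq_zero_of_LOneBall`** — hence `W.analyticRank = 0` (tree: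
  `Literature.NumberTheory.EllipticCurves.analyticRank_eq_zero_of_entireLFunction_one_ne_zero`, unconditional).

Consequence (records `…RanL1Cert…`, gen 21): on the 253 `A = 0` offers the binder `W.analyticRank = 0`
(Cremona `allbsd`) is replaced by `hball0` — an enclosure printed by the same two-engine job as `hballL` —
so that EVERY A-side rank-0 Kurihara offer rests on {published named facts, the newform / parametrization
datum, the engine's enclosures} and no table entry.  Per pair; NOT a class theorem; nothing booked.

References: `AnalyticRankZeroOfLValueBall.lean` (gen 21); B. Birch, H. P. F. Swinnerton-Dyer, J. reine angew.
Math. 218 (1965) [BirchSwinnertonDyer1965]; J. E. Cremona, *Algorithms for modular elliptic curves* (1997)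
§2.8, §3.4 [CremonaAlgorithms1997].
-/

set_option autoImplicit false

noncomputable section

open scoped MatrixGroups ModularForm

open CongruenceSubgroup WeierstrassCurve Literature.NumberTheory.EllipticCurves
  Literature.NumberTheory.EllipticCurves.ModularForms

namespace Summit.BirchSwinnertonDyer.Rank1Residual.Supersingular

/-- **`L(E,1) ≠ 0` FROM THE LEVEL-ONE ENCLOSURE.**  If a ball of radius `rad ≤ R` around a centre `mid` with
`|mid − I| ≤ Mr` contains `den·(c_∞·(re L(E,1)/Ω⁺_f))`, the integer `I` is non-zero and `R + Mr < 1`, then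
`L(E,1) ≠ 0` (otherwise the enclosed quantity is `0` and `|I| ≤ Mr + R < 1`).  Any reals `R, Mr, den, c`.
[cite: BirchSwinnertonDyer1965] [cite: CremonaAlgorithms1997, §2.8 (2.8.8) (PDF p. 26)] -/
theorem entireLFunction_one_ne_zero_of_LOneBall {N : ℕ} [NeZero N] (f : CuspForm (Gamma0 N) 2)
    {W : WeierstrassCurve ℚ} (R Mr den c : ℝ) (I : ℤ) (hI : I ≠ 0) (hsmall : R + Mr < 1)
    (hball0 : ∃ mid rad : ℝ, rad ≤ R ∧ |mid - ((I : ℤ) : ℝ)| ≤ Mr ∧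
      |den * (c * ((W.entireLFunction 1).re / plusPeriod f)) - mid| ≤ rad) :
    W.entireLFunction 1 ≠ 0 := by
  intro hL0
  obtain ⟨mid, rad, h1, h2, h3⟩ := hball0
  rw [hL0, Complex.zero_re, zero_div, mul_zero, mul_zero, zero_sub, abs_neg] at h3
  have hlt : |((I : ℤ) : ℝ)| < 1 :=
    calc |((I : ℤ) : ℝ)| = |(((I : ℤ) : ℝ) - mid) + mid| := by rw [sub_add_cancel]
      _ ≤ |((I : ℤ) : ℝ) - mid| + |mid| := abs_add_le _ _
      _ ≤ Mr + R := add_le_add (by rwa [abs_sub_comm]) (h3.trans h1)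
      _ < 1 := by linarith
  have hz : |I| < 1 := by exact_mod_cast hlt
  exact hI (Int.abs_lt_one_iff.mp hz)

/-- **`r_an(E) = 0` FROM THE LEVEL-ONE ENCLOSURE** — the binder `W.analyticRank = 0` of the `A = 0` rank-0
offers DISCHARGED: `entireLFunction_one_ne_zero_of_LOneBall` followed by the tree's unconditional
`analyticRank_eq_zero_of_entireLFunction_one_ne_zero`.  Side goals on a record: `I ≠ 0` (`decide`),
`R + Mr < 1` (`norm_num`).  Per pair; nothing booked. [cite: BirchSwinnertonDyer1965] -/
theorem analyticRank_eq_zero_of_LOneBall {N : ℕ} [NeZero N] (f : CuspForm (Gamma0 N) 2)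
    {W : WeierstrassCurve ℚ} (R Mr den c : ℝ) (I : ℤ) (hI : I ≠ 0) (hsmall : R + Mr < 1)
    (hball0 : ∃ mid rad : ℝ, rad ≤ R ∧ |mid - ((I : ℤ) : ℝ)| ≤ Mr ∧
      |den * (c * ((W.entireLFunction 1).re / plusPeriod f)) - mid| ≤ rad) :
    W.analyticRank = 0 :=
  Literature.NumberTheory.EllipticCurves.analyticRank_eq_zero_of_entireLFunction_one_ne_zero W
    (entireLFunction_one_ne_zero_of_LOneBall f R Mr den c I hI hsmall hball0)

end Summit.BirchSwinnertonDyer.Rank1Residual.Supersingular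

end
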